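import Literature.Probability.RandomPlanarGeometry.HexSAWPolygonStepTwoStrict
import Literature.Probability.RandomPlanarGeometry.HexSAWPolygonStepTwoMonotone
import HarnessLib

/-!
# XLIX — the STRICT step two `q_N(ℍ) < q_{N+2}(ℍ)` for every even `N ≥ 12`: the two-row witness family

Topic `Literature/Probability/RandomPlanarGeometry` (lane «pcv-sawmu», a-p4 g23; sequel of XLVIII `HexSAWPolygonStepTwoStrict`
(`hexPolygonNumber_lt_add_two_of_witness`) and XLVII `HexSAWPolygonStepTwoStrictBase` (`isPolygon_bdry_rhombus`)).

The witnesses: the two-row parallelograms `rhombRow w a = {(w.x − 2i, w.y)}_{i<a} ∪ {(w.x + 1 − 2i, w.y − 1)}_{i<a}` (`a ≥ 2`; perimeter `4a + 6`; `a = 2` is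
the rhombus) and `rhombRow w a + (w.x, w.y − 2)` (perimeter `4a + 8`); in both the top hexagon `w` has the three lower contacts `L w, LL w, LR w`, so by
XLVIII none of them is (a translate of) an OMEGA image.  Every even perimeter `≥ 14` occurs, whence
★★★ `hexPolygonNumber_lt_add_two (hN : 12 ≤ N) (hE : Even N) : hexPolygonNumber N < hexPolygonNumber (N + 2)` — the honeycomb polygon numbers are STRICTLY
increasing along the even lengths from `12` on (`q_12 = 2 < q_14 = 12 < q_16 = 18 < …`).

Sources: N. Madras, G. Slade, *The Self-Avoiding Walk* (1993), §3.2, Theorem 3.2.3 (3.2.3) p. 64 (`ℤ^d`, non-strict) [MadrasSlade1993]; I. Jensen, J. Phys.: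
Conf. Ser. 42 (2006) 163, §2 [Jensen2006HoneycombPolygons].  Label (lane): LANE THEOREM (strict step two on `ℍ`; the lane's, not the sources').
-/

open Finset

namespace Literature.Probability.RandomPlanarGeometry.SAW

namespace HexCell

open HexBW

/-! ### The two-row parallelograms -/

/-- The two-row parallelogram of width `a` with top-right hexagon `w`: `a` hexagons on the row of `w` going left, `a` hexagons on the row below shifted
right by one. [cite: Jensen2006HoneycombPolygons, §2] -/
def rhombRow (w : Cell) (a : ℕ) : Finset Cell :=
  (range a).image (fun i : ℕ => ((w.1 - 2 * (i : ℤ), w.2) : Cell)) ∪ (range a).image (fun i : ℕ => ((w.1 + 1 - 2 * (i : ℤ), w.2 - 1) : Cell))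

/-- Membership in `rhombRow` by coordinates. [cite: Jensen2006HoneycombPolygons, §2] -/
theorem mem_rhombRow_iff {w p : Cell} {a : ℕ} : p ∈ rhombRow w a ↔
    (p.2 = w.2 ∧ (w.1 - p.1) % 2 = 0 ∧ 0 ≤ w.1 - p.1 ∧ w.1 - p.1 ≤ 2 * (a : ℤ) - 2) ∨
      (p.2 = w.2 - 1 ∧ (w.1 + 1 - p.1) % 2 = 0 ∧ 0 ≤ w.1 + 1 - p.1 ∧ w.1 + 1 - p.1 ≤ 2 * (a : ℤ) - 2) := by
  rw [rhombRow, mem_union, mem_image, mem_image]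
  constructor
  · rintro (⟨i, hi, rfl⟩ | ⟨i, hi, rfl⟩)
    · rw [mem_range] at hi; left; dsimp only; omega
    · rw [mem_range] at hi; right; dsimp only; omega
  · rintro (⟨h2, hpar, h0, ha⟩ | ⟨h2, hpar, h0, ha⟩)
    · left
      refine ⟨((w.1 - p.1) / 2).toNat, mem_range.2 (by omega), Prod.ext ?_ ?_⟩
      · simp; omega
      · simp [h2]
    · right
      refine ⟨((w.1 + 1 - p.1) / 2).toNat, mem_range.2 (by omega), Prod.ext ?_ ?_⟩
      · simp; omega
      · simp [h2]

/-- `rhombRow w a` is a brick set when `w` is a brick. [cite: Jensen2006HoneycombPolygons, §2] -/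
theorem isBrickSet_rhombRow {w : Cell} (hw : Even (w.1 + w.2)) (a : ℕ) : IsBrickSet (rhombRow w a) := by
  intro p hp
  rw [Int.even_iff] at hw ⊢
  rcases mem_rhombRow_iff.1 hp with ⟨h2, hpar, -, -⟩ | ⟨h2, hpar, -, -⟩ <;> omega

/-- The recursion `rhombRow w (a+1) = rhombRow w a + (w.x + 1 − 2a, w.y − 1) + (w.x − 2a, w.y)`. [cite: Jensen2006HoneycombPolygons, §2] -/
theorem rhombRow_succ (w : Cell) (a : ℕ) :
    rhombRow w (a + 1) = insert ((w.1 - 2 * (a : ℤ), w.2) : Cell) (insert ((w.1 + 1 - 2 * (a : ℤ), w.2 - 1) : Cell) (rhombRow w a)) := by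
  ext p
  rw [mem_insert, mem_insert, mem_rhombRow_iff, mem_rhombRow_iff]
  constructor
  · rintro (⟨h2, hpar, h0, ha⟩ | ⟨h2, hpar, h0, ha⟩)
    · by_cases h : w.1 - p.1 = 2 * (a : ℤ)
      · left; exact Prod.ext (by simp; omega) (by simp [h2])
      · right; right; left; exact ⟨h2, hpar, h0, by push_cast at ha ⊢; omega⟩
    · by_cases h : w.1 + 1 - p.1 = 2 * (a : ℤ)
      · right; left; exact Prod.ext (by simp; omega) (by simp [h2])
      · right; right; right; exact ⟨h2, hpar, h0, by push_cast at ha ⊢; omega⟩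
  · rintro (rfl | rfl | ⟨h2, hpar, h0, ha⟩ | ⟨h2, hpar, h0, ha⟩)
    · left; dsimp only; push_cast; omega
    · right; dsimp only; push_cast; omega
    · left; exact ⟨h2, hpar, h0, by push_cast; omega⟩
    · right; exact ⟨h2, hpar, h0, by push_cast; omega⟩

/-- `rhombRow w 2` is the rhombus of XLVII. [cite: Jensen2006HoneycombPolygons, §2] -/
theorem rhombRow_two (w : Cell) : rhombRow w 2 = ({LL w, L w, LR w, w} : Finset Cell) := by
  ext p
  rw [mem_rhombRow_iff]
  simp only [mem_insert, mem_singleton]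
  constructor
  · rintro (⟨h2, hpar, h0, ha⟩ | ⟨h2, hpar, h0, ha⟩)
    · by_cases h : w.1 - p.1 = 0
      · right; right; right; exact Prod.ext (by omega) h2
      · right; left; exact Prod.ext (by simp; omega) (by simp [h2])
    · by_cases h : w.1 + 1 - p.1 = 0
      · right; right; left; exact Prod.ext (by simp; omega) (by simp [h2])
      · left; exact Prod.ext (by simp; omega) (by simp [h2])
  · rintro (rfl | rfl | rfl | rfl)
    · right; simp
    · left; simp
    · right; simp
    · left; simp

/-- ★ **The parallelograms are cell polygons of perimeter `4a + 6`** (`a ≥ 2`), by two insertion moves of XIX per step.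
[cite: MadrasSlade1993, §3.2 (proof of Theorem 3.2.3: the unit-cell surgeries)] [cite: Jensen2006HoneycombPolygons, §2] -/
theorem isPolygon_bdry_rhombRow {w : Cell} (hw : Even (w.1 + w.2)) :
    ∀ a : ℕ, 2 ≤ a → IsPolygon brickWallGraph (bdry (rhombRow w a)) ∧ perim (rhombRow w a) = 4 * a + 6
  | 0, h => by omega
  | 1, h => by omega
  | 2, _ => by rw [rhombRow_two]; exact isPolygon_bdry_rhombus hw
  | a + 3, _ => by
    classical
    obtain ⟨hP, hper⟩ := isPolygon_bdry_rhombRow hw (a + 2) (by omega)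
    have hbs : IsBrickSet (rhombRow w (a + 2)) := isBrickSet_rhombRow hw _
    set c₁ : Cell := (w.1 + 1 - 2 * ((a + 2 : ℕ) : ℤ), w.2 - 1) with hc₁
    set c₂ : Cell := (w.1 - 2 * ((a + 2 : ℕ) : ℤ), w.2) with hc₂
    have hpar₁ : Even (c₁.1 + c₁.2) := by rw [Int.even_iff] at hw ⊢; simp only [hc₁]; push_cast; omega
    have hpar₂ : Even (c₂.1 + c₂.2) := by rw [Int.even_iff] at hw ⊢; simp only [hc₂]; push_cast; omega
    have hnot₁ : c₁ ∉ rhombRow w (a + 2) := by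
      rw [mem_rhombRow_iff]; simp only [hc₁]; push_cast
      rintro (⟨h1, h2, h3, h4⟩ | ⟨h1, h2, h3, h4⟩) <;> omega
    -- first insertion: `c₁` with contact arc `R c₁, UR c₁` (directions 2, 3)
    have harc₁ : ∀ i < 6, nbrDir c₁ (2 + i) ∈ rhombRow w (a + 2) ↔ i < 2 := by
      intro i hi
      interval_cases i
      · rw [show nbrDir c₁ (2 + 0) = R c₁ from rfl, mem_rhombRow_iff]; simp only [R_fst, R_snd, hc₁]; push_cast
        exact ⟨fun _ => trivial, fun _ => Or.inr ⟨trivial, by omega, by omega, by omega⟩⟩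
      · rw [show nbrDir c₁ (2 + 1) = UR c₁ from rfl, mem_rhombRow_iff]; simp only [UR_fst, UR_snd, hc₁]; push_cast
        exact ⟨fun _ => trivial, fun _ => Or.inl ⟨by omega, by omega, by omega, by omega⟩⟩
      · rw [show nbrDir c₁ (2 + 2) = UL c₁ from rfl, mem_rhombRow_iff]; simp only [UL_fst, UL_snd, hc₁]; push_cast
        exact ⟨fun h => by rcases h with ⟨h1, h2, h3, h4⟩ | ⟨h1, h2, h3, h4⟩ <;> omega, fun h => h.elim⟩
      · rw [show nbrDir c₁ (2 + 3) = L c₁ from rfl, mem_rhombRow_iff]; simp only [L_fst, L_snd, hc₁]; push_cast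
        exact ⟨fun h => by rcases h with ⟨h1, h2, h3, h4⟩ | ⟨h1, h2, h3, h4⟩ <;> omega, fun h => h.elim⟩
      · rw [show nbrDir c₁ (2 + 4) = LL c₁ from rfl, mem_rhombRow_iff]; simp only [LL_fst, LL_snd, hc₁]; push_cast
        exact ⟨fun h => by rcases h with ⟨h1, h2, h3, h4⟩ | ⟨h1, h2, h3, h4⟩ <;> omega, fun h => h.elim⟩
      · rw [show nbrDir c₁ (2 + 5) = LR c₁ from rfl, mem_rhombRow_iff]; simp only [LR_fst, LR_snd, hc₁]; push_cast
        exact ⟨fun h => by rcases h with ⟨h1, h2, h3, h4⟩ | ⟨h1, h2, h3, h4⟩ <;> omega, fun h => h.elim⟩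
    have hcard₁ : #(nbrs c₁ ∩ rhombRow w (a + 2)) = 2 := by
      rw [nbrs_inter_eq_image_of_arc (by norm_num) harc₁, card_image_of_injOn, card_range]
      intro i hi j hj h
      have := nbrDir_injective_mod h
      simp only [coe_range, Set.mem_Iio] at hi hj; omega
    have hP₁ := isPolygon_bdry_insert hbs hpar₁ hnot₁ hP (a := 2) (m := 2) (by norm_num) (by norm_num) (by rw [hper]; omega) harc₁
    have hper₁ : perim (insert c₁ (rhombRow w (a + 2))) = 4 * (a + 2) + 8 := by
      rw [perim_insert_of_contacts_eq_two hnot₁ hcard₁, hper]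
    have hbs₁ : IsBrickSet (insert c₁ (rhombRow w (a + 2))) := by
      intro p hp; rcases mem_insert.1 hp with rfl | hp
      · exact hpar₁
      · exact hbs p hp
    -- second insertion: `c₂` with contact arc `LR c₂ = c₁, R c₂` (directions 1, 2)
    have hnot₂ : c₂ ∉ insert c₁ (rhombRow w (a + 2)) := by
      rw [mem_insert, not_or, mem_rhombRow_iff]
      refine ⟨fun e => ?_, ?_⟩
      · have := congrArg Prod.snd e; simp only [hc₁, hc₂] at this; omega
      · simp only [hc₂]; push_cast
        rintro (⟨h1, h2, h3, h4⟩ | ⟨h1, h2, h3, h4⟩) <;> omega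
    have harc₂ : ∀ i < 6, nbrDir c₂ (1 + i) ∈ insert c₁ (rhombRow w (a + 2)) ↔ i < 2 := by
      intro i hi
      interval_cases i
      · rw [show nbrDir c₂ (1 + 0) = LR c₂ from rfl, mem_insert]
        exact ⟨fun _ => by omega, fun _ => Or.inl (Prod.ext (by simp only [LR_fst, hc₁, hc₂]; ring) (by simp only [LR_snd, hc₁, hc₂]))⟩
      · rw [show nbrDir c₂ (1 + 1) = R c₂ from rfl, mem_insert, mem_rhombRow_iff]
        refine ⟨fun _ => by omega, fun _ => Or.inr (Or.inl ?_)⟩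
        simp only [R_fst, R_snd, hc₂]; push_cast
        exact ⟨trivial, by omega, by omega, by omega⟩
      · rw [show nbrDir c₂ (1 + 2) = UR c₂ from rfl, mem_insert, mem_rhombRow_iff]
        refine ⟨fun h => ?_, fun h => absurd h (by omega)⟩
        rcases h with h | h
        · have := congrArg Prod.snd h; simp only [UR_snd, hc₁, hc₂] at this; omega
        · simp only [UR_fst, UR_snd, hc₂] at h; push_cast at h
          rcases h with ⟨h1, h2, h3, h4⟩ | ⟨h1, h2, h3, h4⟩ <;> omega
      · rw [show nbrDir c₂ (1 + 3) = UL c₂ from rfl, mem_insert, mem_rhombRow_iff]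
        refine ⟨fun h => ?_, fun h => absurd h (by omega)⟩
        rcases h with h | h
        · have := congrArg Prod.snd h; simp only [UL_snd, hc₁, hc₂] at this; omega
        · simp only [UL_fst, UL_snd, hc₂] at h; push_cast at h
          rcases h with ⟨h1, h2, h3, h4⟩ | ⟨h1, h2, h3, h4⟩ <;> omega
      · rw [show nbrDir c₂ (1 + 4) = L c₂ from rfl, mem_insert, mem_rhombRow_iff]
        refine ⟨fun h => ?_, fun h => absurd h (by omega)⟩
        rcases h with h | h
        · have := congrArg Prod.snd h; simp only [L_snd, hc₁, hc₂] at this; omega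
        · simp only [L_fst, L_snd, hc₂] at h; push_cast at h
          rcases h with ⟨h1, h2, h3, h4⟩ | ⟨h1, h2, h3, h4⟩ <;> omega
      · rw [show nbrDir c₂ (1 + 5) = LL c₂ from rfl, mem_insert, mem_rhombRow_iff]
        refine ⟨fun h => ?_, fun h => absurd h (by omega)⟩
        rcases h with h | h
        · have := congrArg Prod.fst h; simp only [LL_fst, hc₁, hc₂] at this; omega
        · simp only [LL_fst, LL_snd, hc₂] at h; push_cast at h
          rcases h with ⟨h1, h2, h3, h4⟩ | ⟨h1, h2, h3, h4⟩ <;> omega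
    have hcard₂ : #(nbrs c₂ ∩ insert c₁ (rhombRow w (a + 2))) = 2 := by
      rw [nbrs_inter_eq_image_of_arc (by norm_num) harc₂, card_image_of_injOn, card_range]
      intro i hi j hj h
      have := nbrDir_injective_mod h
      simp only [coe_range, Set.mem_Iio] at hi hj; omega
    have hP₂ := isPolygon_bdry_insert hbs₁ hpar₂ hnot₂ hP₁ (a := 1) (m := 2) (by norm_num) (by norm_num) (by rw [hper₁]; omega) harc₂
    have e : rhombRow w (a + 3) = insert c₂ (insert c₁ (rhombRow w (a + 2))) := by
      rw [show a + 3 = (a + 2) + 1 by ring, rhombRow_succ]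
    rw [e]
    exact ⟨hP₂, by rw [perim_insert_of_contacts_eq_two hnot₂ hcard₂, hper₁]; ring⟩

/-- In `rhombRow w a` (`a ≥ 2`) the top hexagon is `w` and its three lower neighbours are present. [cite: MadrasSlade1993, §3.2 (proof of Theorem 3.2.3)] -/
theorem rhombRow_top {w : Cell} {a : ℕ} (ha : 2 ≤ a) :
    IsLexmax (rhombRow w a) w ∧ L w ∈ rhombRow w a ∧ LL w ∈ rhombRow w a ∧ LR w ∈ rhombRow w a := by
  refine ⟨⟨?_, fun p hp => ?_⟩, ?_, ?_, ?_⟩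
  · rw [mem_rhombRow_iff]; left; exact ⟨rfl, by simp, by simp, by omega⟩
  · rcases mem_rhombRow_iff.1 hp with ⟨h2, -, h0, -⟩ | ⟨h2, -, -, -⟩
    · right; exact ⟨h2, by omega⟩
    · left; omega
  · rw [mem_rhombRow_iff]; left; exact ⟨by simp, by simp, by simp, by simp only [L_fst]; omega⟩
  · rw [mem_rhombRow_iff]; right; exact ⟨by simp, by simp only [LL_fst]; omega, by simp only [LL_fst]; omega, by simp only [LL_fst]; omega⟩
  · rw [mem_rhombRow_iff]; right; exact ⟨by simp, by simp only [LR_fst]; omega, by simp only [LR_fst]; omega, by simp only [LR_fst]; omega⟩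

/-- ★ **The parallelogram with one hexagon hung below `w`**: `rhombRow w a + (w.x, w.y − 2)` is a cell polygon of perimeter `4a + 8` (`a ≥ 2`; the new
hexagon touches `LL w` and `LR w`, arc of two contacts), with the same top. [cite: MadrasSlade1993, §3.2 (proof of Theorem 3.2.3)] -/
theorem isPolygon_bdry_rhombRow_hang {w : Cell} (hw : Even (w.1 + w.2)) {a : ℕ} (ha : 2 ≤ a) :
    IsPolygon brickWallGraph (bdry (insert ((w.1, w.2 - 2) : Cell) (rhombRow w a))) ∧ perim (insert ((w.1, w.2 - 2) : Cell) (rhombRow w a)) = 4 * a + 8 ∧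
      IsBrickSet (insert ((w.1, w.2 - 2) : Cell) (rhombRow w a)) ∧ IsLexmax (insert ((w.1, w.2 - 2) : Cell) (rhombRow w a)) w := by
  classical
  obtain ⟨hP, hper⟩ := isPolygon_bdry_rhombRow hw a ha
  have hbs : IsBrickSet (rhombRow w a) := isBrickSet_rhombRow hw _
  set d : Cell := (w.1, w.2 - 2) with hd
  have hpar : Even (d.1 + d.2) := by rw [Int.even_iff] at hw ⊢; simp only [hd]; omega
  have hnot : d ∉ rhombRow w a := by
    rw [mem_rhombRow_iff]; simp only [hd]
    rintro (⟨h1, h2, h3, h4⟩ | ⟨h1, h2, h3, h4⟩) <;> omega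
  -- contact arc of `d`: `UR d = LR w`, `UL d = LL w` (directions 3, 4)
  have harc : ∀ i < 6, nbrDir d (3 + i) ∈ rhombRow w a ↔ i < 2 := by
    intro i hi
    interval_cases i
    · rw [show nbrDir d (3 + 0) = UR d from rfl, mem_rhombRow_iff]; simp only [UR_fst, UR_snd, hd]
      exact ⟨fun _ => by omega, fun _ => Or.inr ⟨by omega, by omega, by omega, by omega⟩⟩
    · rw [show nbrDir d (3 + 1) = UL d from rfl, mem_rhombRow_iff]; simp only [UL_fst, UL_snd, hd]
      exact ⟨fun _ => by omega, fun _ => Or.inr ⟨by omega, by omega, by omega, by omega⟩⟩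
    · rw [show nbrDir d (3 + 2) = L d from rfl, mem_rhombRow_iff]; simp only [L_fst, L_snd, hd]
      exact ⟨fun h => by rcases h with ⟨h1, h2, h3, h4⟩ | ⟨h1, h2, h3, h4⟩ <;> omega, fun h => absurd h (by omega)⟩
    · rw [show nbrDir d (3 + 3) = LL d from rfl, mem_rhombRow_iff]; simp only [LL_fst, LL_snd, hd]
      exact ⟨fun h => by rcases h with ⟨h1, h2, h3, h4⟩ | ⟨h1, h2, h3, h4⟩ <;> omega, fun h => absurd h (by omega)⟩
    · rw [show nbrDir d (3 + 4) = LR d from rfl, mem_rhombRow_iff]; simp only [LR_fst, LR_snd, hd]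
      exact ⟨fun h => by rcases h with ⟨h1, h2, h3, h4⟩ | ⟨h1, h2, h3, h4⟩ <;> omega, fun h => absurd h (by omega)⟩
    · rw [show nbrDir d (3 + 5) = R d from rfl, mem_rhombRow_iff]; simp only [R_fst, R_snd, hd]
      exact ⟨fun h => by rcases h with ⟨h1, h2, h3, h4⟩ | ⟨h1, h2, h3, h4⟩ <;> omega, fun h => absurd h (by omega)⟩
  have hcard : #(nbrs d ∩ rhombRow w a) = 2 := by
    rw [nbrs_inter_eq_image_of_arc (by norm_num) harc, card_image_of_injOn, card_range]
    intro i hi j hj h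
    have := nbrDir_injective_mod h
    simp only [coe_range, Set.mem_Iio] at hi hj; omega
  refine ⟨isPolygon_bdry_insert hbs hpar hnot hP (a := 3) (m := 2) (by norm_num) (by norm_num) (by rw [hper]; omega) harc,
    by rw [perim_insert_of_contacts_eq_two hnot hcard, hper], ?_, ?_⟩
  · intro p hp; rcases mem_insert.1 hp with rfl | hp
    · exact hpar
    · exact hbs p hp
  · obtain ⟨⟨hwm, hmax⟩, -⟩ := rhombRow_top (w := w) ha
    refine ⟨mem_insert_of_mem hwm, fun p hp => ?_⟩
    rcases mem_insert.1 hp with rfl | hp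
    · left; simp only [hd]; omega
    · exact hmax p hp

/-! ### The strict step two -/

/-- ★★★ **The STRICT step two on the honeycomb lattice**: `q_N(ℍ) < q_{N+2}(ℍ)` for every even `N ≥ 12` — the honeycomb polygon numbers are strictly
increasing along the even lengths from `12` on.  Witness of perimeter `N + 2`: `rhombRow 0 a` if `N + 2 = 4a + 6`, `rhombRow 0 a` with the hung hexagon if
`N + 2 = 4a + 8`; XLVIII does the counting. [cite: MadrasSlade1993, §3.2, Theorem 3.2.3 (3.2.3) p. 64 (non-strict, `ℤ^d`; the strict `ℍ` form is the lane's)]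
[cite: Jensen2006HoneycombPolygons, §2] -/
theorem hexPolygonNumber_lt_add_two {N : ℕ} (hN : 12 ≤ N) (hE : Even N) : hexPolygonNumber N < hexPolygonNumber (N + 2) := by
  have h0 : Even (((0, 0) : Cell).1 + ((0, 0) : Cell).2) := by simp
  obtain ⟨m, rfl⟩ := hE
  -- `N = 2m`, `m ≥ 6`; `N + 2 = 4a + 6` with `a = (m − 2)/2` if `m` is even, `= 4a + 8` with `a = (m − 3)/2` if `m` is odd
  rcases Nat.even_or_odd m with ⟨b, rfl⟩ | ⟨b, rfl⟩
  · -- `N = 4b`, `N + 2 = 4b + 2 = 4(b−1) + 6`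
    obtain ⟨hP, hper⟩ := isPolygon_bdry_rhombRow h0 (b - 1) (by omega)
    obtain ⟨hmax, hL, hLL, hLR⟩ := rhombRow_top (w := ((0, 0) : Cell)) (a := b - 1) (by omega)
    exact hexPolygonNumber_lt_add_two_of_witness hN ⟨b + b, by ring⟩ (isBrickSet_rhombRow h0 _) hP (by rw [hper]; omega) hmax ⟨hL, hLL, hLR⟩
  · -- `N = 4b + 2`, `N + 2 = 4b + 4 = 4(b−1) + 8`
    obtain ⟨hP, hper, hbs, hmax⟩ := isPolygon_bdry_rhombRow_hang h0 (a := b - 1) (by omega)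
    obtain ⟨-, hL, hLL, hLR⟩ := rhombRow_top (w := ((0, 0) : Cell)) (a := b - 1) (by omega)
    exact hexPolygonNumber_lt_add_two_of_witness hN ⟨2 * b + 1, by ring⟩ hbs hP (by rw [hper]; omega) hmax
      ⟨mem_insert_of_mem hL, mem_insert_of_mem hLL, mem_insert_of_mem hLR⟩

/-- ★★ **Strict monotonicity along the even lengths from `12` on**: `q_N(ℍ) < q_{N'}(ℍ)` for even `12 ≤ N < N'`.
[cite: MadrasSlade1993, §3.2, Theorem 3.2.3 (3.2.3) p. 64] -/
theorem hexPolygonNumber_strictMono {N N' : ℕ} (hN : 12 ≤ N) (hNN' : N < N') (hE : Even N) (hE' : Even N') :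
    hexPolygonNumber N < hexPolygonNumber N' := by
  have h2 : N + 2 ≤ N' := by
    obtain ⟨a, rfl⟩ := hE; obtain ⟨b, rfl⟩ := hE'; omega
  exact (hexPolygonNumber_lt_add_two hN hE).trans_le
    (hexPolygonNumber_mono (by omega) h2 (by obtain ⟨a, rfl⟩ := hE; exact ⟨a + 1, by ring⟩) hE')

end HexCell

end Literature.Probability.RandomPlanarGeometry.SAW
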